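import Summits.QuantumAdvantage.QuantumAdvantage.Theorems.CubicForrelationNearExactIsExactFlatDegreeTransfer

/-!
# Crux `CubicForrelation.NearExactIsExact` (stmt-QuantumAdvantage-14043) — infrastructure: RELATIVE Reed–Muller weight bricks on a flat
  (second weight for every order, the Kasami–Tokura list for order 3, and the minimum-weight words are sub-flats)

Certificate seat `b2b-cforr-cert` (gen 29).  HONEST FRAMING: bookkeeping lemmas (standard axioms) — the tree's ABSOLUTE bricks
`sw_second_weight_all`, `kt3_weights_all`, `mw_flat_of_minweight` (stated for `Fin m → Bool` with `IsDegLeFun`) transported to a Boolean /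
integer function living on an abstract flat `c ⊕ V ⊂ 𝔽₂ⁿ` through the coset → cube transfer `ffd_transfer` (…FlatDegreeTransfer).  They are
the "relative Kasami–Tokura" tools asked for by PLAN-N12-WINDOW-O5.md §C–D for the remaining level-5 branches of the `n = 12` window
(`57/64 < Φ < 29/32`): case α (`A₂` is an 8-flat) and the rigid case (`#L₅`).  NOT summit progress; no value of `θ₁₂` is claimed here.

Relative degree `≤ r` on the flat `c ⊕ V` (directions in the xor-closed `V ∋ 0`, `#V = 2^m`) is expressed, as everywhere in the tree, by EVEN
counts on every parametrised `(r+1)`-flat (Boolean form) or by `2 ∣ Σ` over every parametrised `(r+1)`-flat (integer form, the odd set playing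
the role of the support).
* `ffw_second_weight` / `ffw_second_weight_int`: `r ≥ 2`, support non-empty and `2^{r+1}·# < 3·2^m` ⇒ `2^r·# = 2^m`
  (Kasami–Tokura: no weight of `RM(r,m)` strictly between `d = 2^{m−r}` and `3d/2`).
* `ffw_kt3_weights` / `ffw_kt3_weights_int`: `r = 3`, `4·# < 2^m` ⇒ `# = 0`, or `4·# + 2^s = 2^m` with `2s ≥ m+1`, or `32·# = 7·2^m`.
* `ffw_minweight_flat` / `ffw_minweight_flat_int`: `r = d+1` and `2^{d+1}·# = 2^m` (minimum weight) ⇒ the support is a flat `x₁ ⊕ V₁` with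
  `V₁ ⊆ V`, `V₁ ∋ 0` xor-closed, `#V₁ = #support`, and every `v ∈ V₁` is a period of the function along the coset.

References: T. Kasami, N. Tokura, *On the weight structure of Reed–Muller codes*, IEEE Trans. Inform. Theory 16 (1970) 752–759, Thm 1;
F. J. MacWilliams, N. J. A. Sloane, *The Theory of Error-Correcting Codes* (1977), Ch. 13 §3 (restriction of RM codes to flats) and Ch. 15;
C. Carlet, *Boolean Functions for Cryptography and Coding Theory*, CUP 2021, §4.1.  Everything is proved from Mathlib and the tree; axioms are
the standard three.
-/

set_option linter.dupNamespace false -- D-0017: single-problem summit ⇒ `QuantumAdvantage.QuantumAdvantage` by design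

noncomputable section

namespace Summit.QuantumAdvantage.QuantumAdvantage.Theorems.CubicForrelation.NearExactIsExact

open Finset
open Literature.Computability.QuantumComplexity
open Literature.Computability.QuantumComplexity.BuzetChailloux (bxor zeroVec bxor_bxor_cancel_left bxor_zeroVec zeroVec_bxor bxor_comm
  bxor_self)

variable {n : ℕ}

/-! ### Boolean form -/

/-- **Relative second weight (Kasami–Tokura) on a flat.**  `V ∋ 0` xor-closed with `#V = 2^m`, `h` with even parametrised `(r+1)`-flat counts
on `c ⊕ V` (`r ≥ 2`), support non-empty and of size `< 3·2^{m−r−1}` ⇒ the support has exactly `2^{m−r}` points.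
[cite: KasamiTokura1970, Thm 1] -/
theorem ffw_second_weight {m r : ℕ} (hr : 2 ≤ r) (V : Finset (Fin n → Bool)) (h0 : zeroVec ∈ V)
    (hadd : ∀ x ∈ V, ∀ y ∈ V, bxor x y ∈ V) (hcard : #V = 2 ^ m) (c : Fin n → Bool) (h : (Fin n → Bool) → Bool)
    (hflat : ∀ x ∈ V.image (bxor c), ∀ a : Fin (r + 1) → Fin n → Bool, (∀ i, a i ∈ V) →
      Even #(univ.filter fun ε : Fin (r + 1) → Bool =>
        h (fun j => x j ^^ decide (Odd #(univ.filter fun i => ε i && a i j))) = true))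
    (hne : ∃ x ∈ V.image (bxor c), h x = true)
    (hlt : 2 ^ (r + 1) * #((V.image (bxor c)).filter fun x => h x = true) < 3 * 2 ^ m) :
    2 ^ r * #((V.image (bxor c)).filter fun x => h x = true) = 2 ^ m := by
  classical
  obtain ⟨b, -, -, hsurj, hdeg, hcount⟩ := ffd_transfer V h0 hadd hcard c h hflat
  rw [hcount] at hlt ⊢
  refine sw_second_weight_all r hr m _ hdeg ?_ hlt
  obtain ⟨x, hx, hxt⟩ := hne
  obtain ⟨v, hv, rfl⟩ := mem_image.1 hx
  obtain ⟨θ, hθ⟩ := hsurj v hv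
  refine ⟨θ, ?_⟩
  show h (bxor c (fun j => zeroVec j ^^ decide (Odd #(univ.filter fun i => θ i && b i j)))) = true
  rw [hθ]; exact hxt

/-- **Relative Kasami–Tokura list for order 3 on a flat.**  `h` with even parametrised 4-flat counts on `c ⊕ V` (`#V = 2^m`) and
`4·#support < 2^m` ⇒ `#support = 0`, or `4·#support + 2^s = 2^m` with `2s ≥ m + 1`, or `32·#support = 7·2^m`. [cite: KasamiTokura1970, Thm 1] -/
theorem ffw_kt3_weights {m : ℕ} (V : Finset (Fin n → Bool)) (h0 : zeroVec ∈ V)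
    (hadd : ∀ x ∈ V, ∀ y ∈ V, bxor x y ∈ V) (hcard : #V = 2 ^ m) (c : Fin n → Bool) (h : (Fin n → Bool) → Bool)
    (hflat : ∀ x ∈ V.image (bxor c), ∀ a : Fin (3 + 1) → Fin n → Bool, (∀ i, a i ∈ V) →
      Even #(univ.filter fun ε : Fin (3 + 1) → Bool =>
        h (fun j => x j ^^ decide (Odd #(univ.filter fun i => ε i && a i j))) = true))
    (h4 : 4 * #((V.image (bxor c)).filter fun x => h x = true) < 2 ^ m) :
    #((V.image (bxor c)).filter fun x => h x = true) = 0 ∨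
      (∃ s, 4 * #((V.image (bxor c)).filter fun x => h x = true) + 2 ^ s = 2 ^ m ∧ m + 1 ≤ 2 * s) ∨
      32 * #((V.image (bxor c)).filter fun x => h x = true) = 7 * 2 ^ m := by
  classical
  obtain ⟨b, -, -, -, hdeg, hcount⟩ := ffd_transfer V h0 hadd hcard c h hflat
  rw [hcount] at h4 ⊢
  exact kt3_weights_all _ hdeg h4

/-- **Relative minimum-weight words are flats.**  `h` with even parametrised `(d+2)`-flat counts on `c ⊕ V` (`V ∋ 0` xor-closed, `#V = 2^m`)
and `2^{d+1}·#support = 2^m` ⇒ there is `V₁ ⊆ V`, `V₁ ∋ 0` xor-closed with `#V₁ = #support`, every `v ∈ V₁` a period of `h` along the coset,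
and `support = x₁ ⊕ V₁` for every `x₁` in the support. [cite: MacWilliamsSloane1977, Ch. 13 §3] -/
theorem ffw_minweight_flat {m d : ℕ} (V : Finset (Fin n → Bool)) (h0 : zeroVec ∈ V)
    (hadd : ∀ x ∈ V, ∀ y ∈ V, bxor x y ∈ V) (hcard : #V = 2 ^ m) (c : Fin n → Bool) (h : (Fin n → Bool) → Bool)
    (hflat : ∀ x ∈ V.image (bxor c), ∀ a : Fin (d + 1 + 1) → Fin n → Bool, (∀ i, a i ∈ V) →
      Even #(univ.filter fun ε : Fin (d + 1 + 1) → Bool =>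
        h (fun j => x j ^^ decide (Odd #(univ.filter fun i => ε i && a i j))) = true))
    (hS : 2 ^ (d + 1) * #((V.image (bxor c)).filter fun x => h x = true) = 2 ^ m) :
    ∃ V₁ : Finset (Fin n → Bool), V₁ ⊆ V ∧ zeroVec ∈ V₁ ∧ (∀ x ∈ V₁, ∀ y ∈ V₁, bxor x y ∈ V₁) ∧
      #V₁ = #((V.image (bxor c)).filter fun x => h x = true) ∧
      (∀ v ∈ V₁, ∀ x ∈ V.image (bxor c), h (bxor x v) = h x) ∧
      ∀ x₁ ∈ V.image (bxor c), h x₁ = true → ((V.image (bxor c)).filter fun x => h x = true) = V₁.image (bxor x₁) := by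
  classical
  obtain ⟨b, hbV, hinj, hsurj, hdeg, hcount⟩ := ffd_transfer V h0 hadd hcard c h hflat
  -- the frame parametrisation `φ` and the pulled-back function `ψ`
  set φ : (Fin m → Bool) → (Fin n → Bool) := fun θ => fun j => zeroVec j ^^ decide (Odd #(univ.filter fun i => θ i && b i j)) with hφ
  set ψ : (Fin m → Bool) → Bool := fun θ => h (bxor c (φ θ)) with hψ
  have hφmem : ∀ θ, φ θ ∈ V := ffd_flatPt_mem V h0 hadd b hbV
  have hφadd : ∀ θ θ', φ (bxor θ θ') = bxor (φ θ) (φ θ') := fun θ θ' => ffr_flatPt_add b θ θ'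
  have hφinj : Function.Injective φ := hinj
  have hdegψ : IsDegLeFun (d + 1) ψ := hdeg
  have hcountψ : #((V.image (bxor c)).filter fun x => h x = true) = #(univ.filter fun θ => ψ θ = true) := hcount
  have hSψ : 2 ^ (d + 1) * #(univ.filter fun θ => ψ θ = true) = 2 ^ m := by rw [← hcountψ]; exact hS
  obtain ⟨hW0, hWadd, hWcard, hWstr⟩ := mw_flat_of_minweight d ψ hdegψ hSψ
  set W := univ.filter (fun a : Fin m → Bool => ∀ θ, ψ (bxor θ a) = ψ θ) with hWdef
  refine ⟨W.image φ, ?_, ?_, ?_, ?_, ?_, ?_⟩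
  · intro v hv
    obtain ⟨a, -, rfl⟩ := mem_image.1 hv
    exact hφmem a
  · exact mem_image.2 ⟨zeroVec, hW0, ffr_flatPt_zero b⟩
  · intro x hx y hy
    obtain ⟨a, ha, rfl⟩ := mem_image.1 hx
    obtain ⟨a', ha', rfl⟩ := mem_image.1 hy
    exact mem_image.2 ⟨bxor a a', hWadd a ha a' ha', hφadd a a'⟩
  · rw [card_image_of_injective _ hφinj, hWcard, hcountψ]
  · intro v hv x hx
    obtain ⟨a, ha, rfl⟩ := mem_image.1 hv
    obtain ⟨w, hw, rfl⟩ := mem_image.1 hx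
    obtain ⟨θ, hθ⟩ := hsurj w hw
    have haW : ∀ θ, ψ (bxor θ a) = ψ θ := (mem_filter.1 ha).2
    have e1 : bxor (bxor c w) (φ a) = bxor c (φ (bxor θ a)) := by
      rw [hφadd, iw_bxor_assoc]
      show bxor c (bxor w (φ a)) = bxor c (bxor (φ θ) (φ a))
      rw [show φ θ = w from hθ]
    have e2 : bxor c w = bxor c (φ θ) := by rw [show φ θ = w from hθ]
    rw [e1, e2]
    exact haW θ
  · intro x₁ hx₁ hx₁t
    obtain ⟨w₁, hw₁, rfl⟩ := mem_image.1 hx₁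
    obtain ⟨θ₁, hθ₁⟩ := hsurj w₁ hw₁
    have hψ₁ : ψ θ₁ = true := by
      show h (bxor c (φ θ₁)) = true
      rw [show φ θ₁ = w₁ from hθ₁]; exact hx₁t
    have hstr := hWstr θ₁ hψ₁
    ext x
    simp only [mem_filter, mem_image]
    constructor
    · rintro ⟨⟨w, hw, rfl⟩, hxt⟩
      obtain ⟨θ, hθ⟩ := hsurj w hw
      have hψθ : ψ θ = true := by
        show h (bxor c (φ θ)) = true
        rw [show φ θ = w from hθ]; exact hxt
      have hθmem : θ ∈ univ.filter (fun θ => ψ θ = true) := mem_filter.2 ⟨mem_univ _, hψθ⟩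
      rw [hstr] at hθmem
      obtain ⟨a, ha, hθa⟩ := mem_image.1 hθmem
      refine ⟨φ a, ⟨a, ha, rfl⟩, ?_⟩
      have ew₁ : φ θ₁ = w₁ := hθ₁
      have ew : φ θ = w := hθ
      rw [← ew₁, ← ew, ← hθa, hφadd, iw_bxor_assoc]
    · rintro ⟨v, ⟨a, ha, rfl⟩, rfl⟩
      have hmem : bxor θ₁ a ∈ univ.filter (fun θ => ψ θ = true) := by
        rw [hstr]; exact mem_image.2 ⟨a, ha, rfl⟩
      have hψa : ψ (bxor θ₁ a) = true := (mem_filter.1 hmem).2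
      refine ⟨⟨bxor w₁ (φ a), hadd w₁ hw₁ _ (hφmem a), (iw_bxor_assoc c w₁ (φ a)).symm⟩, ?_⟩
      have e : bxor (bxor c w₁) (φ a) = bxor c (φ (bxor θ₁ a)) := by
        rw [hφadd, iw_bxor_assoc, show φ θ₁ = w₁ from hθ₁]
      rw [e]; exact hψa

/-! ### Integer form (the odd set of an integer function with `2 ∣` every `(r+1)`-flat sum) -/

/-- `2 ∣ Σ_flat ψ` ⇒ the number of flat parameters where `ψ` is odd is even. [folklore] -/
theorem ffw_even_count_of_dvd {k : ℕ} (ψ : (Fin n → Bool) → ℤ) (x : Fin n → Bool) (a : Fin k → Fin n → Bool)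
    (H : (2 : ℤ) ∣ ∑ ε : Fin k → Bool, ψ (fun j => x j ^^ decide (Odd #(univ.filter fun i => ε i && a i j)))) :
    Even #(univ.filter fun ε : Fin k → Bool =>
      decide (Odd (ψ (fun j => x j ^^ decide (Odd #(univ.filter fun i => ε i && a i j))))) = true) := by
  classical
  have hE := (tw_even_sum_iff univ _).1 (even_iff_two_dvd.2 H)
  have e : (univ.filter fun ε : Fin k → Bool =>
      Odd (ψ (fun j => x j ^^ decide (Odd #(univ.filter fun i => ε i && a i j))))) =
      univ.filter fun ε : Fin k → Bool =>
        decide (Odd (ψ (fun j => x j ^^ decide (Odd #(univ.filter fun i => ε i && a i j))))) = true :=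
    filter_congr fun ε _ => by simp
  rwa [e] at hE

/-- The support of `x ↦ [ψ x odd]` is the odd set of `ψ`. [folklore] -/
theorem ffw_filter_decide_odd (S : Finset (Fin n → Bool)) (ψ : (Fin n → Bool) → ℤ) :
    (S.filter fun x => decide (Odd (ψ x)) = true) = S.filter fun x => Odd (ψ x) :=
  filter_congr fun x _ => by simp

/-- **Relative second weight, integer form.**  `ψ` integer-valued with `2 ∣ Σ ψ` over every parametrised `(r+1)`-flat of `c ⊕ V` (`r ≥ 2`,
`#V = 2^m`) and fewer than `3·2^{m−r−1}` odd values on the coset ⇒ `ψ` is even on the whole coset, or odd on exactly `2^{m−r}` of its points.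
[cite: KasamiTokura1970, Thm 1] -/
theorem ffw_second_weight_int {m r : ℕ} (hr : 2 ≤ r) (V : Finset (Fin n → Bool)) (h0 : zeroVec ∈ V)
    (hadd : ∀ x ∈ V, ∀ y ∈ V, bxor x y ∈ V) (hcard : #V = 2 ^ m) (c : Fin n → Bool) (ψ : (Fin n → Bool) → ℤ)
    (H : ∀ x ∈ V.image (bxor c), ∀ a : Fin (r + 1) → Fin n → Bool, (∀ i, a i ∈ V) →
      (2 : ℤ) ∣ ∑ ε : Fin (r + 1) → Bool, ψ (fun j => x j ^^ decide (Odd #(univ.filter fun i => ε i && a i j))))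
    (hlt : 2 ^ (r + 1) * #((V.image (bxor c)).filter fun x => Odd (ψ x)) < 3 * 2 ^ m) :
    (∀ x ∈ V.image (bxor c), Even (ψ x)) ∨ 2 ^ r * #((V.image (bxor c)).filter fun x => Odd (ψ x)) = 2 ^ m := by
  classical
  by_cases hex : ∃ x ∈ V.image (bxor c), Odd (ψ x)
  · right
    have key := ffw_second_weight hr V h0 hadd hcard c (fun x => decide (Odd (ψ x)))
      (fun x hx a ha => ffw_even_count_of_dvd ψ x a (H x hx a ha))
      (by obtain ⟨x, hx, hodd⟩ := hex; exact ⟨x, hx, decide_eq_true hodd⟩)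
      (by rw [ffw_filter_decide_odd]; exact hlt)
    rwa [ffw_filter_decide_odd] at key
  · left
    push Not at hex
    exact fun x hx => Int.not_odd_iff_even.1 (hex x hx)

/-- **Relative Kasami–Tokura list for order 3, integer form.**  `2 ∣ Σ ψ` over every parametrised 4-flat of `c ⊕ V` (`#V = 2^m`) and
`4·#odd < 2^m` ⇒ `#odd = 0`, or `4·#odd + 2^s = 2^m` with `2s ≥ m+1`, or `32·#odd = 7·2^m`. [cite: KasamiTokura1970, Thm 1] -/
theorem ffw_kt3_weights_int {m : ℕ} (V : Finset (Fin n → Bool)) (h0 : zeroVec ∈ V)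
    (hadd : ∀ x ∈ V, ∀ y ∈ V, bxor x y ∈ V) (hcard : #V = 2 ^ m) (c : Fin n → Bool) (ψ : (Fin n → Bool) → ℤ)
    (H : ∀ x ∈ V.image (bxor c), ∀ a : Fin (3 + 1) → Fin n → Bool, (∀ i, a i ∈ V) →
      (2 : ℤ) ∣ ∑ ε : Fin (3 + 1) → Bool, ψ (fun j => x j ^^ decide (Odd #(univ.filter fun i => ε i && a i j))))
    (h4 : 4 * #((V.image (bxor c)).filter fun x => Odd (ψ x)) < 2 ^ m) :
    #((V.image (bxor c)).filter fun x => Odd (ψ x)) = 0 ∨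
      (∃ s, 4 * #((V.image (bxor c)).filter fun x => Odd (ψ x)) + 2 ^ s = 2 ^ m ∧ m + 1 ≤ 2 * s) ∨
      32 * #((V.image (bxor c)).filter fun x => Odd (ψ x)) = 7 * 2 ^ m := by
  classical
  have key := ffw_kt3_weights V h0 hadd hcard c (fun x => decide (Odd (ψ x)))
    (fun x hx a ha => ffw_even_count_of_dvd ψ x a (H x hx a ha)) (by rw [ffw_filter_decide_odd]; exact h4)
  rwa [ffw_filter_decide_odd] at key

/-- **Relative minimum-weight odd sets are flats, integer form.**  `2 ∣ Σ ψ` over every parametrised `(d+2)`-flat of `c ⊕ V` (`V ∋ 0`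
xor-closed, `#V = 2^m`) and exactly `2^{m−d−1}` odd values ⇒ the odd set is `x₁ ⊕ V₁` (`V₁ ⊆ V` xor-closed, `#V₁ = #odd`), and the
parity of `ψ` is `V₁`-periodic along the coset. [cite: MacWilliamsSloane1977, Ch. 13 §3] -/
theorem ffw_minweight_flat_int {m d : ℕ} (V : Finset (Fin n → Bool)) (h0 : zeroVec ∈ V)
    (hadd : ∀ x ∈ V, ∀ y ∈ V, bxor x y ∈ V) (hcard : #V = 2 ^ m) (c : Fin n → Bool) (ψ : (Fin n → Bool) → ℤ)
    (H : ∀ x ∈ V.image (bxor c), ∀ a : Fin (d + 1 + 1) → Fin n → Bool, (∀ i, a i ∈ V) →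
      (2 : ℤ) ∣ ∑ ε : Fin (d + 1 + 1) → Bool, ψ (fun j => x j ^^ decide (Odd #(univ.filter fun i => ε i && a i j))))
    (hS : 2 ^ (d + 1) * #((V.image (bxor c)).filter fun x => Odd (ψ x)) = 2 ^ m) :
    ∃ V₁ : Finset (Fin n → Bool), V₁ ⊆ V ∧ zeroVec ∈ V₁ ∧ (∀ x ∈ V₁, ∀ y ∈ V₁, bxor x y ∈ V₁) ∧
      #V₁ = #((V.image (bxor c)).filter fun x => Odd (ψ x)) ∧
      (∀ v ∈ V₁, ∀ x ∈ V.image (bxor c), (Odd (ψ (bxor x v)) ↔ Odd (ψ x))) ∧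
      ∀ x₁ ∈ V.image (bxor c), Odd (ψ x₁) → ((V.image (bxor c)).filter fun x => Odd (ψ x)) = V₁.image (bxor x₁) := by
  classical
  obtain ⟨V₁, hsub, h10, h1add, h1card, hper, hstr⟩ := ffw_minweight_flat V h0 hadd hcard c (fun x => decide (Odd (ψ x)))
    (fun x hx a ha => ffw_even_count_of_dvd ψ x a (H x hx a ha)) (by rw [ffw_filter_decide_odd]; exact hS)
  rw [ffw_filter_decide_odd] at h1card hstr
  refine ⟨V₁, hsub, h10, h1add, h1card, fun v hv x hx => ?_, fun x₁ hx₁ hodd => hstr x₁ hx₁ (decide_eq_true hodd)⟩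
  have e := hper v hv x hx
  constructor
  · intro h1; exact of_decide_eq_true (e ▸ decide_eq_true h1)
  · intro h1; exact of_decide_eq_true (e.symm ▸ decide_eq_true h1)

end Summit.QuantumAdvantage.QuantumAdvantage.Theorems.CubicForrelation.NearExactIsExact

end
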